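import Mathlib
import Literature.MathematicalPhysics.QuantumFieldTheory.Balaban1983to89.B13Closing
import Literature.MathematicalPhysics.QuantumFieldTheory.Balaban1983to89.B12StepObligation

/-!
# `Balaban1983to89.B12StepFromB13` — the kernel EDGE [II] §2 (closing chain) ⇒ [I] Theorem 3 (step obligation)

T. Bałaban, *Renormalization group approach to lattice gauge field theories. I. Generation of effective actions in a
small field approximation and a coupling constant renormalization in four dimensions*, Commun. Math. Phys. **109**,
249–301 (1987) [Balaban1987RG1] (cell paper B12 = "[I]"; PDF page = journal page − 248,
`paper:balaban1987-cmp109-rg-i-small-field`) and *II. Cluster expansions*, Commun. Math. Phys. **116**, 1–22 (1988)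
[Balaban1988RG2Cluster] (cell paper B13 = "[II]"; journal page = PDF page, `paper:balaban1988-cmp116-rg-ii-cluster`).

CITATION HEADER (lean-in-tree rule 2026-08-18).  This module is a pure JOINER of two modules already in the tree and
quotes nothing afresh: `…Balaban1983to89.B13Closing` (unit b13-g3: §2's closing chain pp. 20–22 of [II] with the
[26]-step DISCHARGED from the tree-proved Kotecký–Preiss theorem (unit pv18, `…B13Resummation`) and the polymer geometry
of a window of ℤ^d CONSTRUCTED (unit pv22, `…TreeLengthCubeSystem`)) and `…Balaban1983to89.B12StepObligation` (unit b03,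
cross-read pv20: the clause list `Step.SFNewTerm T c k` of the inductive step `k → k+1` of [I] Theorem 3 p. 264, sourced
clause by clause, and the run-level shape `Step.B12Thm3Shape`).  The sentences repeated in the docstrings below were
quoted and render-checked there (cell GAPS.md C-B13-11, C-pv24-8, G-pv20-2): [II] p. 1 *"We prove also that terms of
this expansion satisfy the inductive assumptions formulated in the first paper. Thus we complete the proof of Theorem 3 of
that paper."*; [II] p. 21 *"The inequality (2.41) and the assumptions imply the inequality (I.1.18), with ½E₀ instead of
E₀, for the terms of the effective action E^{(k+1)} in (I.1.3)."* and *"This yields the bounds (I.1.18) for terms of the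
effective action in the representation (I.1.6) also."*; [II] p. 22 *"The above remark completes the proof of the inductive
assumptions for the action A_{k+1}, hence the proof of Theorem I.3."*; [I] p. 269 *"Thus the proof of Theorem 3 is reduced
to proving the remaining properties of (2.13), i.e. to a construction of the representation (1.7) with terms having the
analytic extensions satisfying the bound (1.18)."*  Cell records: GAPS.md C-pv18-7 (this edge), G-B13-12 / G-B13-12a
(the UNPRINTED log Z^{(k)} estimate), G-b12-2 (ii) / G-adv2-3 / G-adv2-6 (the UNSOURCED β-smoothness clause), G-B13-11 /
C-pv18-3 (the [26]-step); unit `b2b-balaban-pv18` gen 2, journal claim B12-STEP-FROM-B13-KERNEL.  Nothing existing is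
modified; NO statement is minted: every hypothesis below is a named leaf of the two imported modules, merely PACKAGED
(the `structure … : Prop` bundles of Part 1 are conjunctions of those hypotheses, field for field).  v2 (append-only Part 5):
NON-VACUITY of the numerics — explicit constants with `ε₁ > 0` satisfying `KPNumerics` ∧ `ClosingNumerics` at any
geometry constants `κ₀ ≥ 0`, `K₀, ν, c₁ ≥ 1`, in particular at the d = 4 window constants (`Witness.*`; says nothing about
the values of the constants of [I]/[II]).

WHAT IS PROVED HERE (kernel-checked bookkeeping, zero `sorry`) — the COMPLETE remaining hypothesis list of the small-field
inductive step of Theorem I.3 in the cell's typing, in each of the two readings of "the new term" that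
`…B12StepObligation` distinguishes (the cell's tower `Step.SFTower` carries `log Z^{(j)}` apart, `action13`):
* READING (I.1.3) — the new term is `E^{(k+1)}(X)` of (2.13) alone (`StepDict.F g = StepData.Ek1`).  Per step `k`, for
  every value `g ∈ [0, γ]` of the coupling at which the step is performed: a polymer geometry of 𝐃_{k+1}
  (`B13Resummation.Geometry`), the restriction property of the spaces ([II] p. 15, `SpRestr`), the representation (2.13)
  (`Repr213`), the restrictions (`StepData.Restr`) and LEMMA 3_ℓ (`B13.Lemma3With` — the analytic heart of [II],
  pp. 13–20, a HYPOTHESIS), plus the explicit numerics `KPNumerics` (`(1 − 10δ)ℓ = 1`, `O(1)C₃ε₁ ≤ ½E₀`, "κ large"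
  `κ + 2κ₀ + 2 ≤ (1 − 8δ)ℓκ`, "ε₁ small" `C₃ε₁e^{5κ+1}K₀νc₁ ≤ 1`, `e ν c₁ K₀² ≤ A₂`, signs) give the bound (I.1.18) with
  ½E₀ for `E^{(k+1)}` (`NewTermLeaves.bound118` = unit pv18's `B13Resummation.bound118_of_KP`); with the reader's
  dictionary (`StepDict`), the constant comparison (`ConstsCompare`), (2.15), the gauge invariance of the spaces ([I]
  p. 263), the §5 source of the β-bound (`Beta542Source`) and the UNSOURCED smoothness clause of [I] p. 264
  (`BetaSmoothAt`) this is the per-step deliverable `Step.SFNewTerm T c k` (`sfNewTerm_of_newTermLeaves`).  In this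
  reading NEITHER the log Z^{(k)} leaf NOR `δ₀M ≥ κ + 1` occurs.
* READING (I.1.6) — the new term is `E^{(k+1)}(X) + Elog(X)` (`StepDict.F g = StepData.Etot`): the same leaves PLUS the
  UNPRINTED per-LM-cube log Z^{(k)} leaf `‖Elog(X)‖ ≤ B·#cubes(X)·e^{−δ₀M d_{k+1}(X)}` with `B·c₁ ≤ ½E₀` ([II] p. 21 *"We
  define ½E₀ as equal to this constant"*; `B13.LogHalfBound`, cell GAPS G-B13-12a), `κ + 1 ≤ δ₀M` (`R24sharp`) and
  (I.1.7) / analyticity / gauge invariance of the gathered terms (`TotalLeaves`, `ClosingNumerics`) give [II]'s delivered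
  clauses (`TotalLeaves.deliverables` = unit b13-g3's `B13Closing.deliverables_of_KP_logHalf`), hence the per-step
  deliverable (`sfNewTerm_of_totalLeaves` = `B12StepObligation.sfNewTerm_of_deliverables`).
* ON A CONCRETE WINDOW of ℤ^d (unit pv22's `TreeLengthCubeSystem.sys B`, d_{k+1} := `treeLen`; step data
  `B13Closing.WindowStep`): the geometry is a THEOREM, so the leaves are stated in their concrete window form
  (`WindowNewTermLeaves`, `WindowTotalLeaves`) and the numerics at the explicit constants ν = 2d + 1, κ₀ = κ₀(4·2^d, 2d),
  K₀ = K₀(4·2^d, 2d), c₁ = 4·2^d (`sfNewTerm_of_window_newTerm`, `sfNewTerm_of_window_total`).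
* RUN LEVEL: window step data for every step `k < K` (given the inductive hypotheses at `k` and the couplings in the
  interval up to `k+1`, under which [II] works) ⇒ the SHAPE of [I] Theorem 3 for the run, `Step.B12Thm3Shape`
  (`b12Thm3Shape_of_windows_newTerm`, `b12Thm3Shape_of_windows_total`; the induction on `k` is unit f2's, consumed through
  `Step.B12Thm3Shape_iff_obligation` exactly as in `B12StepObligation.b12Thm3Shape_of_deliverables`).

WHAT IS *NOT* CLAIMED.  (i) Lemma 3 ([II] pp. 13–20; by reference to the machinery of [I] §§3–4) is a hypothesis
(`Lemma3With`), as are the log Z^{(k)} estimate (printed nowhere in the series, cell GAPS G-B13-12), the β-smoothness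
clause (asserted [I] p. 264, proved nowhere, G-b12-2 (ii)), the §5 assertions (5.10)/(5.42) packaged in
`Beta542Source`, the restrictions `Restr`, and the abstract predicates `Repr17` / `Analytic` / `GaugeInv` of the carrier.
(ii) The dictionary `StepDict` (how the tower's localization domains, configurations and new term are represented by
[II]'s carrier) is reader-supplied DATA, exactly as in `…B12StepObligation`.  (iii) The window has free boundary (no torus
wrap-around; unit pv22's caveat).  (iv) Which reading of "the new term" the series intends is not decided here — both
are provided, as in `…B12StepObligation`.  Value = kernel-checked bookkeeping (the DAG edge b13 → b12 with its complete
leaf list), NOT summit progress.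
-/

namespace Literature.MathematicalPhysics.QuantumFieldTheory.Balaban1983to89.B12StepFromB13

open Literature.MathematicalPhysics.QuantumFieldTheory.Balaban1983to89
open Literature.MathematicalPhysics.QuantumFieldTheory.Balaban1983to89.B13
open Literature.MathematicalPhysics.QuantumFieldTheory.Balaban1983to89.B13Resummation
open Literature.MathematicalPhysics.QuantumFieldTheory.Balaban1983to89.B13ScaleTransfer
open Literature.MathematicalPhysics.QuantumFieldTheory.Balaban1983to89.B12TreeDecay
open Literature.MathematicalPhysics.QuantumFieldTheory.Balaban1983to89.TreeLengthCubeSystem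
open Literature.MathematicalPhysics.QuantumFieldTheory.Balaban1983to89.B13Closing
open Literature.MathematicalPhysics.QuantumFieldTheory.Balaban1983to89.B12StepObligation
open Literature.MathematicalPhysics.QuantumFieldTheory.Balaban1983to89.Step

/-! ## Part 1. The leaf lists of §2's closing chain, packaged (conjunctions of the hypotheses of the imported theorems) -/

/-- THE NUMERICS of the Kotecký–Preiss discharge of the [26]-step and of the first half of p. 21's closing, for a polymer
geometry with constants (κ₀, K₀, ν, c₁) and a transfer factor ℓ — field for field the numerical hypotheses of unit pv18's
`B13Resummation.bound118_of_KP`: signs `0 ≤ O(1)C₃ε₁`, `0 ≤ κ`; "κ sufficiently large" `κ + 2κ₀ + 2 ≤ (1 − 8δ)ℓκ`;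
"ε₁ sufficiently small" `C₃ε₁e^{5κ+1}K₀νc₁ ≤ 1`; `e ν c₁ K₀² ≤ A₂`; the two *"last assumptions"* of p. 21
`(1 − 10δ)ℓ = 1` (`Consts.R22gen`, printed ℓ = L/2) and `O(1)C₃ε₁ ≤ ½E₀` (`Consts.R23`).  A conjunction of hypotheses, not a
claim. [cite: Balaban1988RG2Cluster, p.21 (restrictions after (2.41))] -/
structure KPNumerics (c : B13.Consts) (ℓ κ₀g K₀g νg c₁g : ℝ) : Prop where
  hA : 0 ≤ c.C3act * c.ε₁
  hκ : 0 ≤ c.κ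
  hlarge : c.κ + 2 * κ₀g + 2 ≤ (1 - 8 * c.δ) * ℓ * c.κ
  hsmall : c.C3act * c.ε₁ * Real.exp (5 * c.κ + 1) * K₀g * νg * c₁g ≤ 1
  hA₂ : Real.exp 1 * νg * c₁g * K₀g ^ 2 ≤ c.A₂
  h22 : c.R22gen ℓ
  h23 : c.R23

/-- … and, for the second half of the closing (the log Z^{(k)} terms delivered per LM-cube at rate δ₀M, reading (I.1.6)),
additionally `κ + 1 ≤ δ₀M` (`Consts.R24sharp`, the per-cube sharpening of p. 21's *"we take M sufficiently large, so that
δ₀M ≧ κ"*, cell SMALLNESS.md §2 item 6) and the sign `0 ≤ E₀` — field for field the remaining numerical hypotheses of unit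
b13-g3's `B13Closing.deliverables_of_KP_logHalf`.  A conjunction of hypotheses, not a claim. [cite: Balaban1988RG2Cluster, p.21 (closing paragraph)] -/
structure ClosingNumerics (c : B13.Consts) (ℓ κ₀g K₀g νg c₁g : ℝ) : Prop where
  toKP : KPNumerics c ℓ κ₀g K₀g νg c₁g
  h24 : c.R24sharp
  hE₀ : 0 ≤ c.E₀

/-- THE LEAVES OF READING (I.1.3) for one step performed at one coupling value: the restriction property of the spaces
(p. 15, `B13Resummation.SpRestr`), the representation (2.13) of E^{(k+1)}(X) as the X-localized part of log Ξ of the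
polymer gas (2.11) (`B13Resummation.Repr213`), the restrictions on the constants (`StepData.Restr`) and LEMMA 3 for the
transfer factor ℓ (`B13.Lemma3With`: restrictions ⇒ (2.38)_ℓ; pp. 13–20 — the analytic content of [II], a HYPOTHESIS).
A conjunction of hypotheses, not a claim. [cite: Balaban1988RG2Cluster, Lemma 3 p.20 with (2.13) p.14 and p.15] -/
structure NewTermLeaves (S : B13.StepData) (c : B13.Consts) (ℓ : ℝ) {Cube : Type} [DecidableEq Cube]
    (Gm : Geometry S.Dk1 Cube) : Prop where
  spRestr : SpRestr S Gm
  repr213 : Repr213 S Gm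
  restr : S.Restr
  lemma3 : Lemma3With S c ℓ

/-- **Reading (I.1.3), one step at one coupling value.**  p. 21: *"The inequality (2.41) and the assumptions imply the
inequality (I.1.18), with ½E₀ instead of E₀, for the terms of the effective action E^{(k+1)} in (I.1.3)."* — with the
[26]-step (2.38)_ℓ ⇒ (2.41)_ℓ a THEOREM of the polymer geometry (unit pv18, Kotecký–Preiss): the leaves + the numerics give
`‖E^{(k+1)}(X, φ)‖ ≤ ½E₀ e^{−κ d_{k+1}(X)}` on the spaces.  `B13Resummation.bound118_of_KP`. [cite: Balaban1988RG2Cluster, p.21 (after (2.41))] -/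
theorem NewTermLeaves.bound118 {S : B13.StepData} {c : B13.Consts} {ℓ : ℝ} {Cube : Type} [DecidableEq Cube]
    {Gm : Geometry S.Dk1 Cube} (h : NewTermLeaves S c ℓ Gm) (hn : KPNumerics c ℓ Gm.κ₀ Gm.K₀ Gm.ν Gm.c₁) :
    Bound118 S.Dk1 S.sp2 S.Ek1 (c.E₀ / 2) c.κ :=
  bound118_of_KP S c Gm h.spRestr h.repr213 (h.lemma3 h.restr) hn.h22 hn.h23 hn.hA hn.hκ hn.hlarge hn.hsmall hn.hA₂

/-- THE LEAVES OF READING (I.1.6) for one step performed at one coupling value: those of reading (I.1.3) PLUS the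
UNPRINTED log Z^{(k)} leaf in its per-LM-cube form with its constant tied to ½E₀ — p. 21 *"The expression localized in X
satisfies the bound (I.1.18) with κ replaced by δ₀M, and with an absolute constant instead of E₀. We define ½E₀ as equal
to this constant"* (`B13.LogHalfBound … (#cubes) B (δ₀M)` with `B·c₁ ≤ ½E₀`; the estimate is written nowhere in the
series, cell GAPS G-B13-12 / G-B13-12a) — and (I.1.7) (`Repr17`), analyticity and gauge invariance of the gathered terms
`E^{(k+1)}(X) + Elog(X)` (pp. 15, 21–22).  A conjunction of hypotheses, not a claim. [cite: Balaban1988RG2Cluster, p.21 (closing paragraph)] -/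
structure TotalLeaves (S : B13.StepData) (c : B13.Consts) (ℓ : ℝ) {Cube : Type} [DecidableEq Cube]
    (Gm : Geometry S.Dk1 Cube) : Prop where
  toNewTerm : NewTermLeaves S c ℓ Gm
  logHalf : ∃ B : ℝ, 0 ≤ B ∧
    LogHalfBound S.Dk1 S.sp2 S.Elog (fun X => (Gm.cubes X).card) B (c.δ₀ * c.M) ∧ B * Gm.c₁ ≤ c.E₀ / 2
  repr17 : S.Repr17
  analytic : ∀ X, S.Analytic (S.Etot X) (S.sp2 X)
  gauge : ∀ X, S.GaugeInv (S.Etot X)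

/-- **Reading (I.1.6), one step at one coupling value.**  p. 21: *"This yields the bounds (I.1.18) for terms of the
effective action in the representation (I.1.6) also."* — the leaves + the numerics give [II]'s delivered clauses for
A_{k+1} (`B13.Deliverables`: (I.1.7), analyticity, (I.1.18) with E₀ and κ, gauge invariance).
`B13Closing.deliverables_of_KP_logHalf`. [cite: Balaban1988RG2Cluster, pp.20–22 (Lemma 3 to Thm I.3)] -/
theorem TotalLeaves.deliverables {S : B13.StepData} {c : B13.Consts} {ℓ : ℝ} {Cube : Type} [DecidableEq Cube]
    {Gm : Geometry S.Dk1 Cube} (h : TotalLeaves S c ℓ Gm) (hn : ClosingNumerics c ℓ Gm.κ₀ Gm.K₀ Gm.ν Gm.c₁) :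
    Deliverables S c := by
  obtain ⟨B, hB, hlog, hdef⟩ := h.logHalf
  exact deliverables_of_KP_logHalf S c Gm h.toNewTerm.spRestr h.toNewTerm.repr213 hn.toKP.hA hn.toKP.hκ
    hn.toKP.hlarge hn.toKP.hsmall hn.toKP.hA₂ h.toNewTerm.restr h.toNewTerm.lemma3 hn.toKP.h22 hn.toKP.h23 hn.h24
    hn.hE₀ hB hlog hdef h.repr17 h.analytic h.gauge

/-! ## Part 2. The per-step deliverable of [I] Theorem 3 from the leaves (abstract geometry) -/

section PerStep

variable {P : Params} {G : Type*} [GaugeGroup G] {Φ 𝒢 : Type*}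
variable {T : SFTower P G Φ 𝒢} {c : SFConsts} {k : ℕ} {S : ℝ → B13.StepData} {c13 : B13.Consts} {ℓ : ℝ}

/-- **THE PER-STEP DELIVERABLE, READING (I.1.3).**  [II] p. 22: *"The above remark completes the proof of the inductive
assumptions for the action A_{k+1}, hence the proof of Theorem I.3."* — typed: for the step `k → k+1` of the tower,
performed at every coupling value `g ∈ [0, γ]` with [II]'s carrier `S g` and a polymer geometry `Gm g` of its 𝐃_{k+1},
the leaves of reading (I.1.3) and the numerics (`hleaves`, `hnum`), the reader's dictionary with `F = E^{(k+1)}` (`Δ`,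
`hF`), the comparison of constants, the algebraic clauses (I.1.7) / (I.1.19) of `E^{(k+1)}` at every `g` (`hrepr`, `hgauge`;
TYPING NOTE (1) of `…B12StepObligation`), (2.15), the gauge invariance of the spaces ([I] p. 263), the §5 β-source and the
UNSOURCED smoothness clause ([I] p. 264) give `Step.SFNewTerm T c k`.  NO log Z^{(k)} leaf in this reading.
`B12StepObligation.sfNewTerm_of_bound` ∘ `NewTermLeaves.bound118`. [cite: Balaban1988RG2Cluster, p.22 ("completes the proof of the inductive assumptions for the action A_{k+1}")] -/
theorem sfNewTerm_of_newTermLeaves {Cube : ℝ → Type} [∀ g, DecidableEq (Cube g)]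
    (Gm : ∀ g, Geometry (S g).Dk1 (Cube g)) (Δ : StepDict T c k S) (hF : ∀ g, Δ.F g = (S g).Ek1)
    (hc : ConstsCompare c13 c)
    (hnum : ∀ g, 0 ≤ g → g ≤ c.γ → KPNumerics c13 ℓ (Gm g).κ₀ (Gm g).K₀ (Gm g).ν (Gm g).c₁)
    (hleaves : ∀ g, 0 ≤ g → g ≤ c.γ → NewTermLeaves (S g) c13 ℓ (Gm g))
    (hrepr : ∀ g, (S g).Repr17) (hgauge : ∀ g X, (S g).GaugeInv ((S g).Ek1 X))
    (hrg : 1 / (T.flow.g k) ^ 2 = 1 / (T.flow.g (k+1)) ^ 2 + T.flow.β (k+1) (T.flow.g k))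
    (hsp : SpacesGaugeInvariant T c (k+1)) (hβ : Beta542Source T c k) (hsmooth : BetaSmoothAt T c k) :
    SFNewTerm T c k :=
  have hE : c13.E₀ / 2 ≤ c.E₀ := by linarith [hc.E₀_le, hc.E₀_nonneg]
  have hE' : 0 ≤ c13.E₀ / 2 := by linarith [hc.E₀_nonneg]
  sfNewTerm_of_bound Δ hE hE' hc.κ_le hc.κ_nonneg
    (fun g hg0 hgγ => by rw [hF g]; exact (hleaves g hg0 hgγ).bound118 (hnum g hg0 hgγ)) hrepr
    (fun g X => by rw [hF g]; exact hgauge g X) hrg hsp hβ hsmooth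

/-- **THE PER-STEP DELIVERABLE, READING (I.1.6).**  As `sfNewTerm_of_newTermLeaves`, with the dictionary representing the
gathered terms `E^{(k+1)}(X) + Elog(X)` (`hF : F = Etot`) and the leaves of reading (I.1.6) (incl. the UNPRINTED
log Z^{(k)} leaf) with their numerics: [II]'s delivered clauses at every `g ∈ [0, γ]`, hence `Step.SFNewTerm T c k`.
`B12StepObligation.sfNewTerm_of_deliverables` ∘ `TotalLeaves.deliverables`. [cite: Balaban1988RG2Cluster, p.22 ("completes the proof of the inductive assumptions for the action A_{k+1}")] -/
theorem sfNewTerm_of_totalLeaves {Cube : ℝ → Type} [∀ g, DecidableEq (Cube g)]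
    (Gm : ∀ g, Geometry (S g).Dk1 (Cube g)) (Δ : StepDict T c k S) (hF : ∀ g, Δ.F g = (S g).Etot)
    (hc : ConstsCompare c13 c)
    (hnum : ∀ g, 0 ≤ g → g ≤ c.γ → ClosingNumerics c13 ℓ (Gm g).κ₀ (Gm g).K₀ (Gm g).ν (Gm g).c₁)
    (hleaves : ∀ g, 0 ≤ g → g ≤ c.γ → TotalLeaves (S g) c13 ℓ (Gm g))
    (hrepr : ∀ g, (S g).Repr17) (hgauge : ∀ g X, (S g).GaugeInv ((S g).Etot X))
    (hrg : 1 / (T.flow.g k) ^ 2 = 1 / (T.flow.g (k+1)) ^ 2 + T.flow.β (k+1) (T.flow.g k))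
    (hsp : SpacesGaugeInvariant T c (k+1)) (hβ : Beta542Source T c k) (hsmooth : BetaSmoothAt T c k) :
    SFNewTerm T c k :=
  sfNewTerm_of_deliverables Δ hF hc (fun g hg0 hgγ => (hleaves g hg0 hgγ).deliverables (hnum g hg0 hgγ)) hrepr
    hgauge hrg hsp hβ hsmooth

end PerStep

/-! ## Part 3. The same on a concrete window of ℤ^d (geometry a THEOREM, explicit constants) -/

section Window

open Classical

variable {d : ℕ} {Bw : Finset (Pt d)}

/-- THE LEAVES OF READING (I.1.3) for window step data (`B13Closing.WindowStep`: 𝐃_{k+1} := unit pv22's window system,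
d_{k+1} := `treeLen`), in their concrete form: the restriction property of the spaces (p. 15: a configuration in the
space on X lies in the space on every domain Z ⊆ X), the representation (2.13) over the incompatibility *"Z ∩ Z′ contains
a cube, or a wall of a cube"* of (2.11) (`locE` over `Touch`), the restrictions, Lemma 3_ℓ.  A conjunction of the
hypotheses of unit b13-g3's `B13Closing.deliverables_window`, not a claim. [cite: Balaban1988RG2Cluster, Lemma 3 p.20 with (2.11)–(2.13) p.14 and p.15] -/
structure WindowNewTermLeaves (W : WindowStep Bw) (c : B13.Consts) (ℓ : ℝ) : Prop where
  spRestr : ∀ X Z : (sys Bw).Dom, ∀ φ, Z.1 ⊆ X.1 → φ ∈ W.sp2 X → φ ∈ W.sp2 Z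
  repr213 : ∀ X : (sys Bw).Dom, ∀ φ, φ ∈ W.sp2 X →
    W.Ek1 X φ = locE (Touch Bw) (fun Z : (sys Bw).Dom => cellsOf Bw Z.1) (fun Z => W.H Z φ) (cellsOf Bw X.1)
  restr : W.toStepData.Restr
  lemma3 : Lemma3With W.toStepData c ℓ

/-- Window leaves of reading (I.1.3) ARE leaves of reading (I.1.3) for the CONSTRUCTED geometry `WindowStep.geom`
(= unit pv22's `TreeLengthCubeSystem.geometry Bw`): no geometry hypothesis. [cite: Balaban1988RG2Cluster, (2.11) p.14] -/
theorem WindowNewTermLeaves.toNewTermLeaves {W : WindowStep Bw} {c : B13.Consts} {ℓ : ℝ}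
    (h : WindowNewTermLeaves W c ℓ) : NewTermLeaves W.toStepData c ℓ W.geom :=
  ⟨W.spRestr h.spRestr, W.repr213 h.repr213, h.restr, h.lemma3⟩

/-- The numerics of reading (I.1.3) at the window's explicit constants ν = 2d + 1, κ₀ = κ₀(4·2^d, 2d),
K₀ = K₀(4·2^d, 2d), c₁ = 4·2^d ARE the numerics for the constructed geometry (its constants are these, by `rfl`:
`TreeLengthCubeSystem.geometry_consts`). [folklore] -/
theorem kpNumerics_geom (W : WindowStep Bw) {c : B13.Consts} {ℓ : ℝ}
    (hn : KPNumerics c ℓ (kappa₀ (4 * 2 ^ d) (2 * d)) (K₀ (4 * 2 ^ d) (2 * d)) (2 * (d : ℝ) + 1) (4 * 2 ^ d)) :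
    KPNumerics c ℓ W.geom.κ₀ W.geom.K₀ W.geom.ν W.geom.c₁ :=
  hn

/-- … likewise for the numerics of reading (I.1.6). [folklore] -/
theorem closingNumerics_geom (W : WindowStep Bw) {c : B13.Consts} {ℓ : ℝ}
    (hn : ClosingNumerics c ℓ (kappa₀ (4 * 2 ^ d) (2 * d)) (K₀ (4 * 2 ^ d) (2 * d)) (2 * (d : ℝ) + 1)
      (4 * 2 ^ d)) :
    ClosingNumerics c ℓ W.geom.κ₀ W.geom.K₀ W.geom.ν W.geom.c₁ :=
  hn

/-- **Reading (I.1.3) on a window, one step at one coupling value**: the window leaves + the numerics at the explicit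
constants give `‖E^{(k+1)}(X, φ)‖ ≤ ½E₀ e^{−κ·treeLen X}` on the spaces — (1.26), (2.27), (2.29)/(2.30) being THEOREMS for
`treeLen` (unit pv22) and the [26]-step a THEOREM from Kotecký–Preiss (unit pv18). [cite: Balaban1988RG2Cluster, p.21 (after (2.41))] -/
theorem WindowNewTermLeaves.bound118 {W : WindowStep Bw} {c : B13.Consts} {ℓ : ℝ} (h : WindowNewTermLeaves W c ℓ)
    (hn : KPNumerics c ℓ (kappa₀ (4 * 2 ^ d) (2 * d)) (K₀ (4 * 2 ^ d) (2 * d)) (2 * (d : ℝ) + 1) (4 * 2 ^ d)) :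
    Bound118 W.toStepData.Dk1 W.toStepData.sp2 W.toStepData.Ek1 (c.E₀ / 2) c.κ :=
  h.toNewTermLeaves.bound118 (kpNumerics_geom W hn)

/-- THE LEAVES OF READING (I.1.6) for window step data, in their concrete form: those of reading (I.1.3) PLUS the UNPRINTED
per-cube log Z^{(k)} leaf with the LITERAL cube count, `‖Elog(X, φ)‖ ≤ Bc·#X·e^{−δ₀M·treeLen X}` with `Bc·4·2^d ≤ ½E₀`, and
(I.1.7) / analyticity / gauge invariance of the gathered terms.  A conjunction of the hypotheses of
`B13Closing.deliverables_window`, not a claim. [cite: Balaban1988RG2Cluster, p.21 (closing paragraph)] -/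
structure WindowTotalLeaves (W : WindowStep Bw) (c : B13.Consts) (ℓ : ℝ) : Prop where
  toNewTerm : WindowNewTermLeaves W c ℓ
  logHalf : ∃ Bc : ℝ, 0 ≤ Bc ∧
    LogHalfBound W.toStepData.Dk1 W.toStepData.sp2 W.toStepData.Elog (fun X => X.1.card) Bc (c.δ₀ * c.M) ∧
      Bc * (4 * 2 ^ d) ≤ c.E₀ / 2
  repr17 : W.toStepData.Repr17
  analytic : ∀ X, W.toStepData.Analytic (W.toStepData.Etot X) (W.toStepData.sp2 X)
  gauge : ∀ X, W.toStepData.GaugeInv (W.toStepData.Etot X)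

/-- Window leaves of reading (I.1.6) ARE leaves of reading (I.1.6) for the constructed geometry (the literal cube count is
the geometry's footprint count, `B13Closing.logHalfBound_geom_of_card`; c₁ = 4·2^d by `rfl`). [cite: Balaban1988RG2Cluster, (2.11) p.14] -/
theorem WindowTotalLeaves.toTotalLeaves {W : WindowStep Bw} {c : B13.Consts} {ℓ : ℝ}
    (h : WindowTotalLeaves W c ℓ) : TotalLeaves W.toStepData c ℓ W.geom := by
  obtain ⟨Bc, hB, hlog, hdef⟩ := h.logHalf
  exact ⟨h.toNewTerm.toNewTermLeaves, ⟨Bc, hB, logHalfBound_geom_of_card W hlog, hdef⟩, h.repr17, h.analytic,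
    h.gauge⟩

/-- **Reading (I.1.6) on a window, one step at one coupling value**: the window leaves + the numerics at the explicit
constants give [II]'s delivered clauses for A_{k+1} — unit b13-g3's `B13Closing.deliverables_window` with its hypothesis
list packaged. [cite: Balaban1988RG2Cluster, pp.20–22 (Lemma 3 to Thm I.3)] -/
theorem WindowTotalLeaves.deliverables {W : WindowStep Bw} {c : B13.Consts} {ℓ : ℝ} (h : WindowTotalLeaves W c ℓ)
    (hn : ClosingNumerics c ℓ (kappa₀ (4 * 2 ^ d) (2 * d)) (K₀ (4 * 2 ^ d) (2 * d)) (2 * (d : ℝ) + 1)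
      (4 * 2 ^ d)) :
    Deliverables W.toStepData c :=
  h.toTotalLeaves.deliverables (closingNumerics_geom W hn)

variable {P : Params} {G : Type*} [GaugeGroup G] {Φ 𝒢 : Type*}
variable {T : SFTower P G Φ 𝒢} {c : SFConsts} {k : ℕ} {c13 : B13.Consts} {ℓ : ℝ}

/-- **THE PER-STEP DELIVERABLE ON A WINDOW, READING (I.1.3)**: window step data at every coupling value `g` (`W g`), its
leaves of reading (I.1.3) on `[0, γ]`, the numerics at the explicit constants, the dictionary with `F = E^{(k+1)}`, the
constant comparison, the algebraic clauses at every `g`, (2.15), [I] p. 263, the §5 β-source and the UNSOURCED smoothness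
clause ⇒ `Step.SFNewTerm T c k`.  `sfNewTerm_of_newTermLeaves` at the constructed geometry. [cite: Balaban1988RG2Cluster, p.22 ("completes the proof of the inductive assumptions for the action A_{k+1}")] -/
theorem sfNewTerm_of_window_newTerm (W : ℝ → WindowStep Bw)
    (Δ : StepDict T c k (fun g => (W g).toStepData)) (hF : ∀ g, Δ.F g = (W g).toStepData.Ek1)
    (hc : ConstsCompare c13 c)
    (hnum : KPNumerics c13 ℓ (kappa₀ (4 * 2 ^ d) (2 * d)) (K₀ (4 * 2 ^ d) (2 * d)) (2 * (d : ℝ) + 1) (4 * 2 ^ d))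
    (hleaves : ∀ g, 0 ≤ g → g ≤ c.γ → WindowNewTermLeaves (W g) c13 ℓ)
    (hrepr : ∀ g, (W g).toStepData.Repr17) (hgauge : ∀ g X, (W g).toStepData.GaugeInv ((W g).toStepData.Ek1 X))
    (hrg : 1 / (T.flow.g k) ^ 2 = 1 / (T.flow.g (k+1)) ^ 2 + T.flow.β (k+1) (T.flow.g k))
    (hsp : SpacesGaugeInvariant T c (k+1)) (hβ : Beta542Source T c k) (hsmooth : BetaSmoothAt T c k) :
    SFNewTerm T c k :=
  sfNewTerm_of_newTermLeaves (S := fun g => (W g).toStepData) (fun g => (W g).geom) Δ hF hc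
    (fun g _ _ => kpNumerics_geom (W g) hnum) (fun g hg0 hgγ => (hleaves g hg0 hgγ).toNewTermLeaves) hrepr hgauge hrg
    hsp hβ hsmooth

/-- **THE PER-STEP DELIVERABLE ON A WINDOW, READING (I.1.6)**: as `sfNewTerm_of_window_newTerm` with `F = Etot` and the
leaves of reading (I.1.6).  `sfNewTerm_of_totalLeaves` at the constructed geometry. [cite: Balaban1988RG2Cluster, p.22 ("completes the proof of the inductive assumptions for the action A_{k+1}")] -/
theorem sfNewTerm_of_window_total (W : ℝ → WindowStep Bw)
    (Δ : StepDict T c k (fun g => (W g).toStepData)) (hF : ∀ g, Δ.F g = (W g).toStepData.Etot)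
    (hc : ConstsCompare c13 c)
    (hnum : ClosingNumerics c13 ℓ (kappa₀ (4 * 2 ^ d) (2 * d)) (K₀ (4 * 2 ^ d) (2 * d)) (2 * (d : ℝ) + 1)
      (4 * 2 ^ d))
    (hleaves : ∀ g, 0 ≤ g → g ≤ c.γ → WindowTotalLeaves (W g) c13 ℓ)
    (hrepr : ∀ g, (W g).toStepData.Repr17) (hgauge : ∀ g X, (W g).toStepData.GaugeInv ((W g).toStepData.Etot X))
    (hrg : 1 / (T.flow.g k) ^ 2 = 1 / (T.flow.g (k+1)) ^ 2 + T.flow.β (k+1) (T.flow.g k))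
    (hsp : SpacesGaugeInvariant T c (k+1)) (hβ : Beta542Source T c k) (hsmooth : BetaSmoothAt T c k) :
    SFNewTerm T c k :=
  sfNewTerm_of_totalLeaves (S := fun g => (W g).toStepData) (fun g => (W g).geom) Δ hF hc
    (fun g _ _ => closingNumerics_geom (W g) hnum) (fun g hg0 hgγ => (hleaves g hg0 hgγ).toTotalLeaves) hrepr hgauge
    hrg hsp hβ hsmooth

end Window

/-! ## Part 4. Run level: window step data for every step `k < K` ⇒ the shape of [I] Theorem 3 -/

section Run

variable {P : Params} {G : Type*} [GaugeGroup G] {Φ 𝒢 : Type*}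
variable [MeasurableSpace G] [HaarData G]
variable (av : ∀ j, Averaging P j G) (Tk : ∀ k, RTOp P k G (av k)) (χ GF : ∀ k, Density P k G)
  (bg : Background P G av) (A : ∀ k, Density P k G) (T : SFTower P G Φ 𝒢) (c : SFConsts) (K : ℕ)

/-- **THE WHOLE CHAIN ON WINDOWS, READING (I.1.3).**  [II] p. 1: *"We prove also that terms of this expansion satisfy the
inductive assumptions formulated in the first paper. Thus we complete the proof of Theorem 3 of that paper."* — typed, for
the sequence generated by the small-field transformations with the couplings in the interval: IF at every step `k < K`,
GIVEN the inductive hypotheses at `k` and `0 < g_j ≤ γ` for `j ≤ k+1` (under which [II] works), window step data (window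
`Bw k ⊂ ℤ^d` of the (k+1)-lattice) carry the leaves of reading (I.1.3) at every `g ∈ [0, γ]` — restriction property,
(2.13), restrictions, LEMMA 3_ℓ —, the numerics hold at the explicit constants (uniformly in `k`), the carriers are bound
to the tower with `F = E^{(k+1)}`, the constants compare, the algebraic clauses hold at every `g`, the spaces are gauge
invariant by definition ([I] p. 263), `β_{k+1}` has the §5 source, AND the unsourced smoothness clause of [I] p. 264 holds
— THEN `Step.B12Thm3Shape` is inhabited for this run.  Composition of `sfNewTerm_of_window_newTerm` with unit f2's induction
(`Step.B12Thm3Shape_iff_obligation`) and (2.15) read off the generated sequence (`B12StepObligation.rg_of_satisfiesRG`).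
[cite: Balaban1988RG2Cluster, p.1 and p.22 (completion of the proof of Thm I.3)] -/
theorem b12Thm3Shape_of_windows_newTerm {d : ℕ} (Bw : ℕ → Finset (Pt d))
    (W : ∀ k, ℝ → WindowStep (Bw k)) (c13 : B13.Consts) (ℓ : ℝ)
    (Δ : ∀ k, StepDict T c k (fun g => (W k g).toStepData)) (hF : ∀ k g, (Δ k).F g = (W k g).toStepData.Ek1)
    (hc : ConstsCompare c13 c)
    (hnum : KPNumerics c13 ℓ (kappa₀ (4 * 2 ^ d) (2 * d)) (K₀ (4 * 2 ^ d) (2 * d)) (2 * (d : ℝ) + 1) (4 * 2 ^ d))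
    (hleaves : ∀ k, k < K → SFHyp T c k → T.flow.InInterval c.γ (k+1) →
      ∀ g, 0 ≤ g → g ≤ c.γ → WindowNewTermLeaves (W k g) c13 ℓ)
    (hrepr : ∀ k g, (W k g).toStepData.Repr17)
    (hgauge : ∀ k g X, (W k g).toStepData.GaugeInv ((W k g).toStepData.Ek1 X))
    (hsp : ∀ k, k < K → SpacesGaugeInvariant T c (k+1))
    (hβ : ∀ k, k < K → Beta542Source T c k) (hsmooth : ∀ k, k < K → BetaSmoothAt T c k) :
    B12Thm3Shape av Tk χ GF bg A T c K := by
  refine (B12Thm3Shape_iff_obligation av Tk χ GF bg A T c K).mpr ?_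
  intro hgen hI k hk hH
  have hIk : T.flow.InInterval c.γ (k+1) := fun j hj => hI j (le_trans hj (Nat.succ_le_of_lt hk))
  exact sfNewTerm_of_window_newTerm (W k) (Δ k) (hF k) hc hnum (hleaves k hk hH hIk) (hrepr k) (hgauge k)
    (rg_of_satisfiesRG hgen.rg hk) (hsp k hk) (hβ k hk) (hsmooth k hk)

/-- **THE WHOLE CHAIN ON WINDOWS, READING (I.1.6)**: as `b12Thm3Shape_of_windows_newTerm` with `F = Etot` and the leaves
of reading (I.1.6) (incl. the UNPRINTED log Z^{(k)} leaf and `κ + 1 ≤ δ₀M`). [cite: Balaban1988RG2Cluster, p.1 and p.22 (completion of the proof of Thm I.3)] -/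
theorem b12Thm3Shape_of_windows_total {d : ℕ} (Bw : ℕ → Finset (Pt d))
    (W : ∀ k, ℝ → WindowStep (Bw k)) (c13 : B13.Consts) (ℓ : ℝ)
    (Δ : ∀ k, StepDict T c k (fun g => (W k g).toStepData)) (hF : ∀ k g, (Δ k).F g = (W k g).toStepData.Etot)
    (hc : ConstsCompare c13 c)
    (hnum : ClosingNumerics c13 ℓ (kappa₀ (4 * 2 ^ d) (2 * d)) (K₀ (4 * 2 ^ d) (2 * d)) (2 * (d : ℝ) + 1)
      (4 * 2 ^ d))
    (hleaves : ∀ k, k < K → SFHyp T c k → T.flow.InInterval c.γ (k+1) →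
      ∀ g, 0 ≤ g → g ≤ c.γ → WindowTotalLeaves (W k g) c13 ℓ)
    (hrepr : ∀ k g, (W k g).toStepData.Repr17)
    (hgauge : ∀ k g X, (W k g).toStepData.GaugeInv ((W k g).toStepData.Etot X))
    (hsp : ∀ k, k < K → SpacesGaugeInvariant T c (k+1))
    (hβ : ∀ k, k < K → Beta542Source T c k) (hsmooth : ∀ k, k < K → BetaSmoothAt T c k) :
    B12Thm3Shape av Tk χ GF bg A T c K := by
  refine (B12Thm3Shape_iff_obligation av Tk χ GF bg A T c K).mpr ?_
  intro hgen hI k hk hH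
  have hIk : T.flow.InInterval c.γ (k+1) := fun j hj => hI j (le_trans hj (Nat.succ_le_of_lt hk))
  exact sfNewTerm_of_window_total (W k) (Δ k) (hF k) hc hnum (hleaves k hk hH hIk) (hrepr k) (hgauge k)
    (rg_of_satisfiesRG hgen.rg hk) (hsp k hk) (hβ k hk) (hsmooth k hk)

end Run

/-! ## Part 5. Non-vacuity of the numerics (v2, append-only)

The referee's vacuity audit for new `Prop`-structures: the numerical side conditions packaged in `KPNumerics` /
`ClosingNumerics` — p. 21's *"last assumptions"* `(1 − 10δ)ℓ = 1`, `O(1)C₃ε₁ ≤ ½E₀`, *"κ sufficiently large"*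
`κ + 2κ₀ + 2 ≤ (1 − 8δ)ℓκ`, *"ε₁ sufficiently small"* `C₃ε₁e^{5κ+1}K₀νc₁ ≤ 1`, `e ν c₁ K₀² ≤ A₂`, `κ + 1 ≤ δ₀M` and the
signs — are JOINTLY SATISFIABLE, by explicit real numbers with `ε₁ > 0`, at any polymer-geometry constants `κ₀ ≥ 0`,
`K₀, ν, c₁ ≥ 1`, in particular at the d = 4 window constants of Part 3.  HONEST FRAMING: this says NOTHING about the
values of the constants of [I]/[II] (fixed by the series only as "sufficiently large / small", cell SMALLNESS.md
S-B13.15 / S-B13.17); it only certifies that the typed side conditions do not contradict one another. -/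

namespace Witness

/-- Explicit constants, all entries but `ε₁` (set below): `L = 4` (so the transfer factor `ℓ = 2 = L/2` is the printed
one, `B13.Consts.R22gen_half_iff`), `q = 0`, `κ₁ = 0`, `C₁ = 1`, `C₂ = 0`, `α₄ = α₆ = 1` (so the kernel
`K₀(c) = 2C₁α₄⁻¹α₆⁻¹M^q e^{C₂κ₁} = 2`), `δ = 1/20`, `κ = 10κ₀ + 10`, `δ₀ = 1`, `M = κ + 1`, `A₁ = 1`,
`A₂ = e ν c₁ K₀²`, `E₀ = 2A₂`; the remaining entries are not read by the side conditions. [folklore] -/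
noncomputable def base (κ₀g K₀g νg c₁g : ℝ) : B13.Consts where
  L := 4
  q := 0
  M := 10 * κ₀g + 11
  κ := 10 * κ₀g + 10
  κ₁ := 0
  δ := 1 / 20
  δ₀ := 1
  E₀ := 2 * (Real.exp 1 * νg * c₁g * K₀g ^ 2)
  ε₁ := 0
  C₁ := 1
  C₂ := 0
  C₃ := 1
  α₀ := 1
  α₁ := 1
  α₄ := 1
  α₅ := 1
  α₆ := 1
  γ₂ := 1
  γ := 1
  A₁ := 1
  A₂ := Real.exp 1 * νg * c₁g * K₀g ^ 2

/-- The factor `e^{5κ+1}K₀νc₁` of the "ε₁ small" condition at `κ = 10κ₀ + 10`. [folklore] -/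
noncomputable def rfac (κ₀g K₀g νg c₁g : ℝ) : ℝ := Real.exp (5 * (10 * κ₀g + 10) + 1) * K₀g * νg * c₁g

/-- The witness constants: `base` with `ε₁ := (C₃ · e^{5κ+1}K₀νc₁)⁻¹` (`C₃` = the activity constant `Consts.C3act` of
`base`, which does not read `ε₁`). [folklore] -/
noncomputable def consts (κ₀g K₀g νg c₁g : ℝ) : B13.Consts :=
  { base κ₀g K₀g νg c₁g with ε₁ := ((base κ₀g K₀g νg c₁g).C3act * rfac κ₀g K₀g νg c₁g)⁻¹ }

variable {κ₀g K₀g νg c₁g : ℝ}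

/-- `C₃` of the witness is `C₃` of `base` (the activity constant does not read `ε₁`). [folklore] -/
theorem C3act_consts : (consts κ₀g K₀g νg c₁g).C3act = (base κ₀g K₀g νg c₁g).C3act := rfl

/-- Closed form: `C₃(base) = 2·6⁴·1·(2A₂·2) = 10368·A₂`. [folklore] -/
theorem C3act_base : (base κ₀g K₀g νg c₁g).C3act = 10368 * (Real.exp 1 * νg * c₁g * K₀g ^ 2) := by
  simp only [B13.Consts.C3act, B13.Consts.K₀, base]
  norm_num
  ring

/-- `1 ≤ e^{5κ+1}K₀νc₁` for `κ₀ ≥ 0`, `K₀, ν, c₁ ≥ 1`. [folklore] -/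
theorem one_le_rfac (hκ₀ : 0 ≤ κ₀g) (hK : 1 ≤ K₀g) (hν : 1 ≤ νg) (hc₁ : 1 ≤ c₁g) :
    1 ≤ rfac κ₀g K₀g νg c₁g := by
  unfold rfac
  have h1 : 1 ≤ Real.exp (5 * (10 * κ₀g + 10) + 1) := Real.one_le_exp (by positivity)
  calc (1 : ℝ) = 1 * 1 * 1 * 1 := by ring
    _ ≤ Real.exp (5 * (10 * κ₀g + 10) + 1) * K₀g * νg * c₁g := by gcongr

/-- `0 < A₂ = e ν c₁ K₀²` for `K₀, ν, c₁ ≥ 1`. [folklore] -/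
theorem A₂_pos (hK : 1 ≤ K₀g) (hν : 1 ≤ νg) (hc₁ : 1 ≤ c₁g) : 0 < Real.exp 1 * νg * c₁g * K₀g ^ 2 := by
  have := Real.exp_pos 1
  have : 0 < νg := by linarith
  have : 0 < c₁g := by linarith
  have : 0 < K₀g := by linarith
  positivity

/-- `0 < C₃` of the witness. [folklore] -/
theorem C3act_pos (hK : 1 ≤ K₀g) (hν : 1 ≤ νg) (hc₁ : 1 ≤ c₁g) : 0 < (consts κ₀g K₀g νg c₁g).C3act := by
  rw [C3act_consts, C3act_base]
  exact mul_pos (by norm_num) (A₂_pos hK hν hc₁)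

/-- **The witness has `ε₁ > 0`** (it is not the degenerate `ε₁ = 0`). [folklore] -/
theorem ε₁_pos (hκ₀ : 0 ≤ κ₀g) (hK : 1 ≤ K₀g) (hν : 1 ≤ νg) (hc₁ : 1 ≤ c₁g) :
    0 < (consts κ₀g K₀g νg c₁g).ε₁ := by
  show 0 < ((base κ₀g K₀g νg c₁g).C3act * rfac κ₀g K₀g νg c₁g)⁻¹
  rw [← C3act_consts]
  exact inv_pos.mpr (mul_pos (C3act_pos hK hν hc₁) (lt_of_lt_of_le one_pos (one_le_rfac hκ₀ hK hν hc₁)))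

/-- `C₃ε₁ = (e^{5κ+1}K₀νc₁)⁻¹` for the witness. [folklore] -/
theorem C3act_mul_ε₁ (hK : 1 ≤ K₀g) (hν : 1 ≤ νg) (hc₁ : 1 ≤ c₁g) :
    (consts κ₀g K₀g νg c₁g).C3act * (consts κ₀g K₀g νg c₁g).ε₁ = (rfac κ₀g K₀g νg c₁g)⁻¹ := by
  show (consts κ₀g K₀g νg c₁g).C3act * ((base κ₀g K₀g νg c₁g).C3act * rfac κ₀g K₀g νg c₁g)⁻¹ = _
  rw [← C3act_consts, mul_inv, ← mul_assoc, mul_inv_cancel₀ (C3act_pos hK hν hc₁).ne', one_mul]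

/-- **`KPNumerics` holds for the witness** at transfer factor `ℓ = 2`, for any geometry constants `κ₀ ≥ 0`,
`K₀, ν, c₁ ≥ 1`. [folklore] -/
theorem kpNumerics_consts (hκ₀ : 0 ≤ κ₀g) (hK : 1 ≤ K₀g) (hν : 1 ≤ νg) (hc₁ : 1 ≤ c₁g) :
    KPNumerics (consts κ₀g K₀g νg c₁g) 2 κ₀g K₀g νg c₁g := by
  have hr := one_le_rfac hκ₀ hK hν hc₁
  have hr0 : 0 < rfac κ₀g K₀g νg c₁g := lt_of_lt_of_le one_pos hr
  have hprod := C3act_mul_ε₁ (κ₀g := κ₀g) hK hν hc₁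
  have hA₂ := A₂_pos hK hν hc₁
  refine ⟨?_, ?_, ?_, ?_, ?_, ?_, ?_⟩
  · rw [hprod]; exact inv_nonneg.mpr hr0.le
  · show (0 : ℝ) ≤ 10 * κ₀g + 10
    positivity
  · show 10 * κ₀g + 10 + 2 * κ₀g + 2 ≤ (1 - 8 * (1 / 20)) * 2 * (10 * κ₀g + 10)
    linarith
  · show (consts κ₀g K₀g νg c₁g).C3act * (consts κ₀g K₀g νg c₁g).ε₁ *
        Real.exp (5 * (10 * κ₀g + 10) + 1) * K₀g * νg * c₁g ≤ 1
    have : (consts κ₀g K₀g νg c₁g).C3act * (consts κ₀g K₀g νg c₁g).ε₁ *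
        Real.exp (5 * (10 * κ₀g + 10) + 1) * K₀g * νg * c₁g = (rfac κ₀g K₀g νg c₁g)⁻¹ * rfac κ₀g K₀g νg c₁g := by
      rw [hprod, rfac]; ring
    rw [this, inv_mul_cancel₀ hr0.ne']
  · show Real.exp 1 * νg * c₁g * K₀g ^ 2 ≤ Real.exp 1 * νg * c₁g * K₀g ^ 2
    exact le_rfl
  · show (1 - 10 * (1 / 20 : ℝ)) * 2 = 1
    norm_num
  · show (Real.exp 1 * νg * c₁g * K₀g ^ 2) * (consts κ₀g K₀g νg c₁g).C3act * (consts κ₀g K₀g νg c₁g).ε₁ ≤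
        2 * (Real.exp 1 * νg * c₁g * K₀g ^ 2) / 2
    rw [mul_assoc, hprod]
    have : (rfac κ₀g K₀g νg c₁g)⁻¹ ≤ 1 := inv_le_one_of_one_le₀ hr
    nlinarith

/-- **`ClosingNumerics` holds for the witness** (additionally `κ + 1 ≤ δ₀M` with `δ₀ = 1`, `M = κ + 1`, and
`0 ≤ E₀`). [folklore] -/
theorem closingNumerics_consts (hκ₀ : 0 ≤ κ₀g) (hK : 1 ≤ K₀g) (hν : 1 ≤ νg) (hc₁ : 1 ≤ c₁g) :
    ClosingNumerics (consts κ₀g K₀g νg c₁g) 2 κ₀g K₀g νg c₁g := by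
  refine ⟨kpNumerics_consts hκ₀ hK hν hc₁, ?_, ?_⟩
  · show 10 * κ₀g + 10 + 1 ≤ 1 * (10 * κ₀g + 11)
    linarith
  · show (0 : ℝ) ≤ 2 * (Real.exp 1 * νg * c₁g * K₀g ^ 2)
    linarith [A₂_pos hK hν hc₁]

/-- The d = 4 window constant `K₀(64, 8) = e^{64 log 162}/81` is at least 1. [folklore] -/
theorem one_le_K₀_four : 1 ≤ K₀ (4 * 2 ^ 4) (2 * 4) := by
  have hκ : kappa₀ (4 * 2 ^ 4) (2 * 4) = 64 * Real.log 162 := kappa₀_four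
  unfold K₀
  rw [hκ, le_div_iff₀ (by positivity)]
  have h81 : Real.log 81 ≤ 64 * Real.log 162 := by
    have h1 : Real.log 81 ≤ Real.log 162 := Real.log_le_log (by norm_num) (by norm_num)
    have h2 : 0 ≤ Real.log 162 := Real.log_nonneg (by norm_num)
    linarith
  have h := Real.exp_le_exp.mpr h81
  rw [Real.exp_log (by norm_num : (0 : ℝ) < 81)] at h
  norm_num
  linarith

/-- **NON-VACUITY at the d = 4 window constants**: some constants and transfer factor satisfy `ClosingNumerics` (hence
`KPNumerics`) at `κ₀ = κ₀(64, 8)`, `K₀ = K₀(64, 8)`, `ν = 9`, `c₁ = 64` — the numerics hypotheses of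
`sfNewTerm_of_window_newTerm` / `sfNewTerm_of_window_total` / `b12Thm3Shape_of_windows_*` at `d = 4` are jointly
satisfiable. [folklore] -/
theorem closingNumerics_nonvacuous_four :
    ∃ c : B13.Consts, ∃ ℓ : ℝ, ClosingNumerics c ℓ (kappa₀ (4 * 2 ^ 4) (2 * 4)) (K₀ (4 * 2 ^ 4) (2 * 4))
      (2 * ((4 : ℕ) : ℝ) + 1) (4 * 2 ^ 4) :=
  ⟨consts _ _ _ _, 2, closingNumerics_consts (kappa₀_nonneg (by positivity) _) one_le_K₀_four (by norm_num)
    (by norm_num)⟩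

/-- … and the witness is non-degenerate: its `ε₁` is strictly positive. [folklore] -/
theorem ε₁_pos_four :
    0 < (consts (kappa₀ (4 * 2 ^ 4) (2 * 4)) (K₀ (4 * 2 ^ 4) (2 * 4)) (2 * ((4 : ℕ) : ℝ) + 1) (4 * 2 ^ 4)).ε₁ :=
  ε₁_pos (kappa₀_nonneg (by positivity) _) one_le_K₀_four (by norm_num) (by norm_num)

end Witness

end Literature.MathematicalPhysics.QuantumFieldTheory.Balaban1983to89.B12StepFromB13
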